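import Summits.Ventures.PackingBounds.Configurations.Dim22Card891Data

/-!
# The 891-point sharp configuration on `S²¹` as an explicit section of the Leech lattice: `A(22, arccos 1/4) = 891` and the ground-state energy — kernel checks, part D

Framing: lottery ticket; floor = certified bounds/negative ranges. Histogram chunks `30`–`40` of
the configuration of `Configurations/Dim22Card891Data` (see there and `Configurations/Dim22Card891`).
-/

namespace Summit.Ventures.PackingBounds.Config.Dim22Card891

open Summit.Ventures.PackingBounds.Config

set_option maxRecDepth 100000 in
/-- Kernel check (distance distribution), rows of chunk `30` against the whole configuration. -/
theorem hist_30 : histOK vecs891 table891 vecs891c30 = true := by decide +kernel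

set_option maxRecDepth 100000 in
/-- Kernel check (distance distribution), rows of chunk `31` against the whole configuration. -/
theorem hist_31 : histOK vecs891 table891 vecs891c31 = true := by decide +kernel

set_option maxRecDepth 100000 in
/-- Kernel check (distance distribution), rows of chunk `32` against the whole configuration. -/
theorem hist_32 : histOK vecs891 table891 vecs891c32 = true := by decide +kernel

set_option maxRecDepth 100000 in
/-- Kernel check (distance distribution), rows of chunk `33` against the whole configuration. -/
theorem hist_33 : histOK vecs891 table891 vecs891c33 = true := by decide +kernel

set_option maxRecDepth 100000 in
/-- Kernel check (distance distribution), rows of chunk `34` against the whole configuration. -/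
theorem hist_34 : histOK vecs891 table891 vecs891c34 = true := by decide +kernel

set_option maxRecDepth 100000 in
/-- Kernel check (distance distribution), rows of chunk `35` against the whole configuration. -/
theorem hist_35 : histOK vecs891 table891 vecs891c35 = true := by decide +kernel

set_option maxRecDepth 100000 in
/-- Kernel check (distance distribution), rows of chunk `36` against the whole configuration. -/
theorem hist_36 : histOK vecs891 table891 vecs891c36 = true := by decide +kernel

set_option maxRecDepth 100000 in
/-- Kernel check (distance distribution), rows of chunk `37` against the whole configuration. -/
theorem hist_37 : histOK vecs891 table891 vecs891c37 = true := by decide +kernel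

set_option maxRecDepth 100000 in
/-- Kernel check (distance distribution), rows of chunk `38` against the whole configuration. -/
theorem hist_38 : histOK vecs891 table891 vecs891c38 = true := by decide +kernel

set_option maxRecDepth 100000 in
/-- Kernel check (distance distribution), rows of chunk `39` against the whole configuration. -/
theorem hist_39 : histOK vecs891 table891 vecs891c39 = true := by decide +kernel

set_option maxRecDepth 100000 in
/-- Kernel check (distance distribution), rows of chunk `40` against the whole configuration. -/
theorem hist_40 : histOK vecs891 table891 vecs891c40 = true := by decide +kernel

end Summit.Ventures.PackingBounds.Config.Dim22Card891
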